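import Summits.Ventures.Crystal3D.Theorems.StickyWulffConstantTextureLiminfL12Local
import Summits.Ventures.Crystal3D.Kissing125.Classification
import HarnessLib

/-!
# Leaf closer: lane T `TexShadow` registered stub `stub_kissing` (crux `TextureLiminfV5`, stmt-Ventures-23912)

HONEST FRAMING. Venture `Summits/Ventures/Crystal3D` (cell `crystal3d-full`), route `route-Ventures-StickyWulffConstant`, lane T, line
`TexShadow` v8.20.  The registered input stub `stub_kissing : KissingGap (5/2) ∧ KissingClassification (5/2)` (the two kissing facts
GAP(1.25) and BIMODAL(1.25), computational grade — `Lean.ofReduceBool` through the certified enumerations of `Kissing125`) is the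
conjunction of the tree theorems `Summit.Ventures.Crystal3D.Theorems.kissingGap_250` (…TextureLiminfL12Local) and
`Summit.Ventures.Crystal3D.kissingClassification_250` (Kissing125/Classification); this LEAF module lands it under the stub's
fully-qualified name (cf-p1 ruling (ccxlvii)).  Nothing new is proved; F-C1 not moved.
-/

namespace Summit.Ventures.Crystal3D.Cruxes.TextureLiminf.TexShadow

open Summit.Ventures.Crystal3D

/-- **`stub_kissing` BY NAME**: GAP(1.25) and BIMODAL(1.25) for twelve-point kissing configurations
(`Theorems.kissingGap_250`, `kissingClassification_250`). -/
theorem stub_kissing : KissingGap (5 / 2) ∧ KissingClassification (5 / 2) :=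
  ⟨Summit.Ventures.Crystal3D.Theorems.kissingGap_250, Summit.Ventures.Crystal3D.kissingClassification_250⟩

end Summit.Ventures.Crystal3D.Cruxes.TextureLiminf.TexShadow
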